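import Summits.BirchSwinnertonDyer.BirchSwinnertonDyer.Theorems.ResidualThetaTransportAtTwoThetaLayerLambdaCongruenceAtTwoNoMazurKenku
import Summits.BirchSwinnertonDyer.Rank1Residual.P2.EmptyCellsAtTwo
import Literature.NumberTheory.EllipticCurves.TwoAdicImageSurjectivityModTwoProofs
import Literature.NumberTheory.EllipticCurves.HeegnerPointsKolyvaginLocalCriterion
import Literature.NumberTheory.QuadraticForms.RatPlacesDictionary
import HarnessLib

/-!
# Crux `MazurTateCongruenceAtTwoTop` (stmt-BirchSwinnertonDyer-25797 = 21416 BY NAME, route ThetaPartnerAtTwo, K1 row): the mod-`2` plus line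
# WITHOUT Serre 1972 — `plusLineCharTwo_of_threeFacts (hES) (hSD) (hBz)`

Width seat `bsd-wall-tp2-p1-w4` g0 (`--supports stmt-BirchSwinnertonDyer-25797`; closes nothing; THEOREMS ONLY; BSD is not proved by this).
PUB-REDUCTION: the plus line (C3k) `plusLineCharTwo_of_fourFacts hES hSD hBz hSe` (…NoMazurKenku) uses the named fact
`hSe = serre1972_supersingular_decompositionSubgroup_image` (Serre 1972 Prop. 12 (c),(d)) at exactly one place,
`…StarGalois.finrank_torsionBySet_eq_two_of_facts hBz hSe`, where `ρ̄_{W,2}(D_𝔓) = GL₂(𝔽₂)` (`𝔓 ∣ 2`) supplies the two Galois-side hypotheses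
of Buzzard's mod-`2` multiplicity one — (I) `ρ̄ ⊗ 𝔽̄₂` irreducible, (S) `ρ̄|D_𝔓` non-scalar. Both follow from TREE THEOREMS for `W` globally
minimal and good supersingular at `2`: (I) is GLOBAL — `ρ̄_{W,2}` is onto `GL₂(𝔽₂)` (Dokchitser–Dokchitser clause (1), PROVED in the tree as
`hasSurjectiveModNGaloisRep_two_iff`; inputs `P2.irr_two_of_goodSS_two`, `P2.not_isSquare_Δ_of_goodSS_two`) — §1; (S) is LOCAL but elementary —
`Δ_min ≡ 5 (mod 8)` (`Supersingular.minimalDiscriminantInt_emod_eight_eq_five_of_goodSS_two`) is not a square in `ℚ₂`, so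
`√Δ = 4·∏_{i<j}(x_i − x_j)` (`delta`, `algebraMap_Δ`, `smul_delta`) is moved by some `τ ∈ Gal(ℚ̄₂/ℚ₂)`, whose restriction lies in `D_𝔓`
(tree lemma `resGalOfEmb_mem_decompositionSubgroup`, Neukirch II (9.6)) and has `ρ̄(τ) ≠ 1` — §2. Then §3 `finrank_torsionBySet_eq_two_of_buzzard`
(= `…_of_facts` without `hSe`), §4 `kTwo_of_dvd_of_esSdBz`, §5 **`plusLineCharTwo_of_threeFacts`** with the conclusion of
`plusLineCharTwo_of_fourFacts` VERBATIM, so every consumer of the plus line (K1 `mazurTateCongruence_of_plusLine`, Kan⁺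
`…_of_plusLineLevel_curveMax_nonRoot`) drops `Se` from its print inputs.

References: Dokchitser–Dokchitser, Math. Z. 272 (2012) 961–964, Theorem (1); Buzzard, MRL 7 (2000) Prop. 2.4; Neukirch ANT II (9.6);
Silverman AEC III.§1 (`Δ` and the `2`-division points), VII (minimal models).
-/

noncomputable section

-- justification: the `Summit.BirchSwinnertonDyer.BirchSwinnertonDyer.…` path repeats a component (route-file convention)
set_option linter.dupNamespace false

open scoped MatrixGroups ModularForm NumberField Pointwise Classical
open CongruenceSubgroup Polynomial IsDedekindDomain Field Matrix WeierstrassCurve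
open Literature.NumberTheory.EllipticCurves Literature.NumberTheory.EllipticCurves.ModularForms
open Literature.NumberTheory.EllipticCurves.Rank1Residual Literature.NumberTheory.GaloisRepresentations Rat.HeightOneSpectrum

namespace Summit.BirchSwinnertonDyer.BirchSwinnertonDyer.Theorems.ThetaLayerLambdaCongruenceAtTwo

/-! ## §1 (I) GLOBAL: `ρ̄_{W,2}` is onto `GL₂(𝔽₂)` at a good supersingular `2` -/

/-- **Every element of `GL₂(𝔽₂)` is a `ρ̄_{W,2}(σ)`** for `W` globally minimal and good supersingular at `2`: `ρ̄_{W,2}` is onto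
`Aut(E[2])` by Dokchitser–Dokchitser clause (1) (tree theorem `hasSurjectiveModNGaloisRep_two_iff`), since `E(ℚ)` has no point of
order `2` (`P2.irr_two_of_goodSS_two`) and `Δ ∉ ℚ²` (`P2.not_isSquare_Δ_of_goodSS_two`, `Δ_min ≡ 5 mod 8`); transported to the
frame of `ρ̄`. [cite: DokchitserDokchitserMathZ2012, Theorem (1)] -/
theorem exists_apply_eq_of_goodSS_two (W : WeierstrassCurve ℚ) [W.IsElliptic] [W.IsGloballyMinimal] (hss : GoodSS W 2)
    {ρ : ModPGaloisRep ℚ (ZMod 2) 2} (hρ : W.IsTorsionGaloisRep 2 ρ) (g : GL (Fin 2) (ZMod 2)) :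
    ∃ σ : absoluteGaloisGroup ℚ, ρ σ = g := by
  have hsurj : W.HasSurjectiveModNGaloisRep 2 :=
    (hasSurjectiveModNGaloisRep_two_iff W).mpr
      ⟨(Summit.BirchSwinnertonDyer.Rank1Residual.X5.O1.irr_two_iff_forall_two_nsmul (W := W)).mp
        (Summit.BirchSwinnertonDyer.Rank1Residual.P2.irr_two_of_goodSS_two W hss),
       Summit.BirchSwinnertonDyer.Rank1Residual.P2.not_isSquare_Δ_of_goodSS_two W hss⟩
  obtain ⟨e, he⟩ := hρ
  -- the additive automorphism of `E[2]` with matrix `g` in the frame `e`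
  have hMiM : ((g⁻¹ : GL (Fin 2) (ZMod 2)) : Matrix (Fin 2) (Fin 2) (ZMod 2)) * (g : Matrix (Fin 2) (Fin 2) (ZMod 2)) = 1 :=
    Units.inv_mul g
  have hMMi : (g : Matrix (Fin 2) (Fin 2) (ZMod 2)) * ((g⁻¹ : GL (Fin 2) (ZMod 2)) : Matrix (Fin 2) (Fin 2) (ZMod 2)) = 1 :=
    Units.mul_inv g
  let φ : geomTorsion W 2 ≃+ geomTorsion W 2 :=
    { toFun := fun P ↦ e.symm (Matrix.mulVec (g : Matrix (Fin 2) (Fin 2) (ZMod 2)) (e P))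
      invFun := fun P ↦ e.symm (Matrix.mulVec ((g⁻¹ : GL (Fin 2) (ZMod 2)) : Matrix (Fin 2) (Fin 2) (ZMod 2)) (e P))
      left_inv := fun P ↦ by
        dsimp only
        rw [AddEquiv.apply_symm_apply, Matrix.mulVec_mulVec, hMiM, Matrix.one_mulVec, AddEquiv.symm_apply_apply]
      right_inv := fun P ↦ by
        dsimp only
        rw [AddEquiv.apply_symm_apply, Matrix.mulVec_mulVec, hMMi, Matrix.one_mulVec, AddEquiv.symm_apply_apply]
      map_add' := fun P Q ↦ by
        rw [← map_add, ← Matrix.mulVec_add, ← map_add] }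
  have hφ : ∀ P : geomTorsion W 2, e (φ P) = Matrix.mulVec (g : Matrix (Fin 2) (Fin 2) (ZMod 2)) (e P) := fun P ↦
    e.apply_symm_apply _
  obtain ⟨σ, hσ⟩ := hsurj (Multiplicative.ofAdd φ)
  refine ⟨σ, ?_⟩
  have hσP : ∀ P : geomTorsion W 2, σ • P = φ P := fun P ↦ by
    rw [← galoisRepTorsion_apply W 2 σ P, hσ]; rfl
  have hv : ∀ w : Fin 2 → ZMod 2,
      Matrix.mulVec ((ρ σ : GL (Fin 2) (ZMod 2)) : Matrix (Fin 2) (Fin 2) (ZMod 2)) w =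
        Matrix.mulVec (g : Matrix (Fin 2) (Fin 2) (ZMod 2)) w := fun w ↦ by
    obtain ⟨P, rfl⟩ := e.surjective w
    rw [← he σ P, hσP, hφ]
  refine Matrix.GeneralLinearGroup.ext fun i j ↦ ?_
  have hij := congrFun (hv (Pi.single j 1)) i
  rwa [Matrix.mulVec_single_one, Matrix.mulVec_single_one] at hij

/-! ## §2 (S) LOCAL: at `2` the decomposition group acts non-trivially on `E[2]` -/

/-- **An integer `≡ 5 (mod 8)` is not a square in `ℚ₂`** (a `2`-adic unit square is `≡ 1 (mod 8)`). [folklore] -/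
theorem not_exists_sq_eq_intCast_padic_two {D : ℤ} (hD : D % 8 = 5) {q : ℕ} [hq : Fact q.Prime] (hq2 : q = 2)
    (s : ℚ_[q]) : s ^ 2 ≠ (D : ℚ_[q]) := by
  intro hs
  have hD2 : ¬ (q : ℤ) ∣ D := by rw [hq2]; omega
  have hnD : ‖(D : ℚ_[q])‖ = 1 :=
    le_antisymm (Padic.norm_int_le_one D) (not_lt.mp fun h ↦ hD2 (Padic.norm_intCast_lt_one_iff.mp h))
  have hns : ‖s‖ = 1 := by
    have h1 : ‖s‖ ^ 2 = 1 := by rw [← norm_pow, hs, hnD]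
    nlinarith [norm_nonneg s]
  let u : ℤ_[q] := ⟨s, hns.le⟩
  have hu3 : u ^ 2 = (D : ℤ_[q]) := by
    apply Subtype.ext
    rw [PadicInt.coe_pow, PadicInt.coe_intCast]
    exact hs
  have h8 : 8 ∣ q ^ 3 := by rw [hq2]; norm_num
  let π : ℤ_[q] →+* ZMod 8 := (ZMod.castHom h8 (ZMod 8)).comp (PadicInt.toZModPow 3)
  have hπ := congrArg π hu3
  rw [map_pow, map_intCast] at hπ
  have h5 : ((D : ℤ) : ZMod 8) = 5 := by
    have h : ((D - 5 : ℤ) : ZMod 8) = 0 := (ZMod.intCast_zmod_eq_zero_iff_dvd (D - 5) 8).mpr (by omega)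
    rw [Int.cast_sub, sub_eq_zero] at h
    exact_mod_cast h
  exact (show ∀ x : ZMod 8, x ^ 2 ≠ 5 by decide) _ (hπ.trans h5)

/-- **At a good supersingular `2` the decomposition group of `𝔓_{ι,𝔐}` moves a `2`-torsion point**: for `W/ℚ` globally minimal with
`GoodSS W 2`, the framed `ρ̄ = ρ̄_{W,2}`, `v ∣ 2`, an embedding `ι : ℚ̄ → ℚ̄_v` and a prime `𝔐` of `\bar ℤ_v`, some `σ ∈ D_{𝔓_{ι,𝔐}}`
has `ρ̄(σ) ≠ 1`. PROOF: if `D_𝔓` fixed `E[2]` pointwise, every `τ ∈ Gal(ℚ̄₂/ℚ₂)` (restricting into `D_𝔓`,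
`resGalOfEmb_mem_decompositionSubgroup`) would fix `ι(δ)`, `δ = ∏_{i<j}(x_i − x_j)` (`smul_delta`), so `δ ∈ ℚ₂`
(`K̄_v^{Γ_{K_v}} = K_v`) and `Δ = 16δ²` (`algebraMap_Δ`) would be a square in `ℚ₂`; but `Δ = Δ_min ≡ 5 (mod 8)`.
[cite: SilvermanAEC2009, III.§1 (Δ and the 2-division points)] [cite: NeukirchANT1999, Ch. II §9 Prop. (9.6)] -/
theorem exists_mem_decompositionSubgroup_primeBelow_apply_ne_one_of_goodSS_two (W : WeierstrassCurve ℚ) [W.IsElliptic]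
    [W.IsGloballyMinimal] (hss : GoodSS W 2) {ρ : ModPGaloisRep ℚ (ZMod 2) 2} (hρ : W.IsTorsionGaloisRep 2 ρ)
    {v : HeightOneSpectrum (𝓞 ℚ)} (hv : (primesEquiv v : ℕ) = 2)
    (ι : AlgebraicClosure ℚ →ₐ[ℚ] AlgebraicClosure (v.adicCompletion ℚ)) {𝔐 : Ideal (HeightOneSpectrum.localAbsIntegers v)}
    (h𝔐 : 𝔐 ∈ v.localPrimesAbove) :
    ∃ σ ∈ (v.primeBelow ι 𝔐).decompositionSubgroup (absoluteGaloisGroup ℚ), ρ σ ≠ 1 := by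
  have h2 : (2 : ℚ) ≠ 0 := two_ne_zero
  by_contra hall
  push Not at hall
  -- every `τ ∈ Gal(ℚ̄₂/ℚ₂)` fixes `E[2]` pointwise through `res_ι`
  obtain ⟨e, he⟩ := hρ
  have hfixP : ∀ (τ : absoluteGaloisGroup (v.adicCompletion ℚ)) (P : geomTorsion W 2), resGalOfEmb ι τ • P = P :=
      fun τ P ↦ by
    have hone := hall _ (resGalOfEmb_mem_decompositionSubgroup ι h𝔐 τ)
    apply e.injective
    rw [he, hone, Units.val_one, Matrix.one_mulVec]
  -- hence fixes `δ`
  have hδ : ∀ τ : absoluteGaloisGroup (v.adicCompletion ℚ), resGalOfEmb ι τ • DokchitserDokchitser2012.delta W h2 =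
      DokchitserDokchitser2012.delta W h2 := fun τ ↦ by
    have hperm : DokchitserDokchitser2012.permGal W h2 (resGalOfEmb ι τ) = 1 := by
      rw [← DokchitserDokchitser2012.permGal_one W h2]
      unfold DokchitserDokchitser2012.permGal
      congr 1
      ext P
      rw [DokchitserDokchitser2012.rho_apply, DokchitserDokchitser2012.rho_apply, one_smul, hfixP]
    rw [DokchitserDokchitser2012.smul_delta, hperm, Equiv.Perm.sign_one]; simp
  have hfix : ∀ τ : AlgebraicClosure (v.adicCompletion ℚ) ≃ₐ[v.adicCompletion ℚ] AlgebraicClosure (v.adicCompletion ℚ),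
      τ (ι (DokchitserDokchitser2012.delta W h2)) = ι (DokchitserDokchitser2012.delta W h2) := fun τ ↦ by
    have h := apply_resGalAuxOfEmb_apply ι τ (DokchitserDokchitser2012.delta W h2)
    rw [← resGalOfEmb_apply] at h
    change ι (resGalOfEmb ι τ • DokchitserDokchitser2012.delta W h2) = τ (ι (DokchitserDokchitser2012.delta W h2)) at h
    rw [hδ τ] at h
    exact h.symm
  -- so `ι δ ∈ ℚ_v` (no `CharZero` instance is introduced: it would switch the `ℚ`-algebra structure)
  haveI : PerfectField (v.adicCompletion ℚ) :=
    @PerfectField.ofCharZero _ _ (charZero_of_injective_algebraMap (algebraMap ℚ (v.adicCompletion ℚ)).injective)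
  haveI : IsGalois (v.adicCompletion ℚ) (AlgebraicClosure (v.adicCompletion ℚ)) := {}
  obtain ⟨r, hr⟩ := (InfiniteGalois.mem_range_algebraMap_iff_fixed (ι (DokchitserDokchitser2012.delta W h2))).mpr
    (fun τ ↦ hfix τ)
  -- `Δ = 16 δ²` read in `ℚ̄`, then in `ℚ̄_v`, then in `ℚ_v`
  have hΔbar : (W.Δ : AlgebraicClosure ℚ) = 16 * DokchitserDokchitser2012.delta W h2 ^ 2 := by
    rw [← DokchitserDokchitser2012.algebraMap_Δ W h2]; exact (eq_ratCast _ _).symm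
  have hsq : (W.Δ : v.adicCompletion ℚ) = 16 * r ^ 2 := by
    apply (algebraMap (v.adicCompletion ℚ) (AlgebraicClosure (v.adicCompletion ℚ))).injective
    have h1 : ι (W.Δ : AlgebraicClosure ℚ) = (W.Δ : AlgebraicClosure (v.adicCompletion ℚ)) :=
      map_ratCast (ι : AlgebraicClosure ℚ →+* AlgebraicClosure (v.adicCompletion ℚ)) W.Δ
    rw [map_ratCast, map_mul, map_pow, hr, map_ofNat, ← h1, hΔbar, map_mul, map_pow, map_ofNat]
  -- transport to `ℚ_[2]`: `Δ = Δ_min` would be a square in `ℚ_[2]`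
  haveI : Fact (primesEquiv v : ℕ).Prime := ⟨(primesEquiv v).2⟩
  have hpad : (W.Δ : ℚ_[(primesEquiv v : ℕ)]) =
      16 * ((Rat.HeightOneSpectrum.adicCompletion.padicEquiv (R := 𝓞 ℚ) v).toAlgEquiv.toRingEquiv r) ^ 2 := by
    rw [← Literature.NumberTheory.QuadraticForms.padicEquiv_algebraMap_rat v W.Δ, eq_ratCast, hsq, map_mul, map_pow,
      map_ofNat]
  have h5 := Summit.BirchSwinnertonDyer.Rank1Residual.Supersingular.minimalDiscriminantInt_emod_eight_eq_five_of_goodSS_two W hss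
  refine not_exists_sq_eq_intCast_padic_two h5 hv (4 * (adicCompletion.padicEquiv (R := 𝓞 ℚ) v).toAlgEquiv.toRingEquiv r) ?_
  rw [← Rat.cast_intCast, cast_minimalDiscriminantInt, hpad]
  ring

/-- **At a good supersingular `2` every decomposition group above `2` moves a `2`-torsion point** (Serre-free form of the
non-scalar hypothesis of Buzzard's Prop. 2.4): for `W/ℚ` globally minimal with `GoodSS W 2`, the framed `ρ̄ = ρ̄_{W,2}`, `v ∣ 2`
and any prime `𝔓 ∣ v` of `\bar ℤ`, some `σ ∈ D_𝔓` has `ρ̄(σ) ≠ 1` — from the `𝔓_{ι,𝔐}` case by transitivity of `Γ_ℚ` on the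
primes above `v` (`exists_smul_eq_of_mem_primesAbove_holds`) and `D_{g𝔓} = g D_𝔓 g⁻¹`.
[cite: SilvermanAEC2009, III.§1 (Δ and the 2-division points)] [cite: NeukirchANT1999, Ch. I §9 (9.1), Ch. II §9 Prop. (9.6)] -/
theorem exists_mem_decompositionSubgroup_apply_ne_one_of_goodSS_two (W : WeierstrassCurve ℚ) [W.IsElliptic]
    [W.IsGloballyMinimal] (hss : GoodSS W 2) {ρ : ModPGaloisRep ℚ (ZMod 2) 2} (hρ : W.IsTorsionGaloisRep 2 ρ)
    {v : HeightOneSpectrum (𝓞 ℚ)} (hv : (primesEquiv v : ℕ) = 2) {𝔓 : Ideal (absIntegers (𝓞 ℚ) ℚ)}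
    (h𝔓 : 𝔓 ∈ v.primesAbove) :
    ∃ σ ∈ 𝔓.decompositionSubgroup (absoluteGaloisGroup ℚ), ρ σ ≠ 1 := by
  obtain ⟨𝔐, h𝔐⟩ := v.localPrimesAbove_nonempty
  obtain ⟨g, hg⟩ := HeightOneSpectrum.exists_smul_eq_of_mem_primesAbove_holds
    (HeightOneSpectrum.primeBelow_mem_primesAbove (ι := closureEmb (K := ℚ) (v.adicCompletion ℚ)) h𝔐) h𝔓
  obtain ⟨σ₀, hσ₀, hne⟩ := exists_mem_decompositionSubgroup_primeBelow_apply_ne_one_of_goodSS_two W hss hρ hv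
    (closureEmb (K := ℚ) (v.adicCompletion ℚ)) h𝔐
  refine ⟨g * σ₀ * g⁻¹, ?_, fun h ↦ hne ?_⟩
  · rw [← hg, Ideal.decompositionSubgroup_smul]
    exact Subgroup.smul_mem_pointwise_smul _ _ _ hσ₀
  · rwa [map_mul, map_mul, map_inv, mul_inv_eq_one, mul_eq_left] at h

/-! ## §3 Buzzard's mod-`2` multiplicity one at the eigen-ideal WITHOUT Serre 1972 -/

/-- **`dim_{𝕋/𝔪} J₀(L)[𝔪] = 2` at a mod-`2` eigen-ideal of a good-supersingular-at-`2` curve, from Buzzard's fact ALONE** (=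
`finrank_torsionBySet_eq_two_of_facts` with the hypothesis `serre1972_supersingular_decompositionSubgroup_image` REMOVED; statement otherwise
verbatim). `W/ℚ` globally minimal with `GoodSS W 2`; `L` odd; every prime `p ∤ 2L` good for `W`; `𝔪` a maximal ideal of `𝕋 = HeckeRing0 L 2`
containing `2`, with `|𝕋/𝔪| = 2` and `T_q - a_q(W) ∈ 𝔪` for all primes `q ∤ L`. The hypotheses of `buzzard2000_multiplicityOne_gamma0` hold
with `k = 𝔽̄₂`, `ι : 𝕋/𝔪 ≅ 𝔽₂ → k`, `ρ = ρ̄_{W,2} ⊗ k`: (U) unramified with `charpoly ρ(Frob_p) = X² - ι(T_p) X + p` at `p ∤ 2L` (as before);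
(I) irreducible over `k` — `ρ̄_{W,2}` is ONTO `GL₂(𝔽₂)` (§1, Dokchitser–Dokchitser (1)), so its image contains both transvections;
(S) non-scalar on every `D_𝔓`, `𝔓 ∣ 2` — §2 gives `σ ∈ D_𝔓` with `ρ̄(σ) ≠ 1`, and over `𝔽₂` the only scalar in `GL₂` is `1`.
[cite: Buzzard2000LevelLoweringModTwo, Prop. 2.4 and Def. 2.1–2.2 (p. 100–101)] [cite: DokchitserDokchitserMathZ2012, Theorem (1)] -/
theorem finrank_torsionBySet_eq_two_of_buzzard
    (hBz : buzzard2000_multiplicityOne_gamma0)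
    (W : WeierstrassCurve ℚ) [W.IsElliptic] [W.IsGloballyMinimal] (hss : GoodSS W 2)
    (L : ℕ) [NeZero L] (hL : Odd L)
    (hgood : ∀ v : HeightOneSpectrum (𝓞 ℚ), ¬ ((primesEquiv v : ℕ) ∣ 2 * L) → W.HasGoodReductionAt v)
    (𝔪 : Ideal (HeckeRing0 L 2)) (h𝔪 : 𝔪.IsMaximal) (h2 : (2 : HeckeRing0 L 2) ∈ 𝔪)
    (hq : Nat.card (HeckeRing0 L 2 ⧸ 𝔪) = 2)
    (hT : ∀ (q : ℕ) (hq : q.Prime), ¬ q ∣ L → HeckeRing0.T L 2 q hq - (W.LFunction q : HeckeRing0 L 2) ∈ 𝔪) :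
    Module.finrank (HeckeRing0 L 2 ⧸ 𝔪) (Submodule.torsionBySet (HeckeRing0 L 2) (J0 L) 𝔪) = 2 := by
  classical
  -- the coefficient field `k = 𝔽̄₂` (discrete) and `ι : 𝕋/𝔪 ≅ 𝔽₂ → k`
  let k : Type := AlgebraicClosure (ZMod 2)
  letI : TopologicalSpace k := ⊥
  haveI : DiscreteTopology k := ⟨rfl⟩
  haveI : Finite (HeckeRing0 L 2 ⧸ 𝔪) := Nat.finite_of_card_ne_zero (by rw [hq]; norm_num)
  letI : Fintype (HeckeRing0 L 2 ⧸ 𝔪) := Fintype.ofFinite _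
  have hF : Fintype.card (HeckeRing0 L 2 ⧸ 𝔪) = 2 := by rw [Fintype.card_eq_nat_card, hq]
  let e : ZMod 2 ≃+* HeckeRing0 L 2 ⧸ 𝔪 := ZMod.ringEquivOfPrime _ Nat.prime_two hF
  let f : ZMod 2 →+* k := algebraMap (ZMod 2) k
  let ι : HeckeRing0 L 2 ⧸ 𝔪 →+* k := f.comp e.symm.toRingHom
  have hι : ∀ a : ℤ, ι (Ideal.Quotient.mk 𝔪 (a : HeckeRing0 L 2)) = (a : k) := fun a ↦ by
    simp only [map_intCast]
  -- the mod-`2` representation of `W` and its base change to `k`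
  obtain ⟨ρ₀, hρ₀⟩ := W.exists_isTorsionGaloisRep 2
  let ρ : ModPGaloisRep ℚ k 2 := FramedRep.baseChange f continuous_of_discreteTopology ρ₀
  have hρapp : ∀ σ, ((ρ σ : GL (Fin 2) k) : Matrix (Fin 2) (Fin 2) k) =
      ((ρ₀ σ : GL (Fin 2) (ZMod 2)) : Matrix (Fin 2) (Fin 2) (ZMod 2)).map f := fun σ ↦ rfl
  refine hBz L hL 𝔪 h𝔪 h2 k ι ρ ?_ ?_ ?_
  · -- (U) unramified with the Eichler–Shimura characteristic polynomial at `p ∤ 2L`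
    intro v hv
    have hp2 : ¬ ((primesEquiv v : Nat.Primes) : ℕ) ∣ 2 := fun h ↦ hv (h.mul_right L)
    have hpL : ¬ ((primesEquiv v : Nat.Primes) : ℕ) ∣ L := fun h ↦ hv (Dvd.dvd.mul_left h 2)
    have hgoodv : W.HasGoodReductionAt v := hgood v hv
    have h2v : ((2 : ℕ) : 𝓞 ℚ) ∉ v.asIdeal := fun h ↦ hp2 ((natCast_mem_asIdeal_iff_primesEquiv_dvd v 2).mp h)
    refine ⟨?_, ?_⟩
    · intro 𝔓 h𝔓 σ hσ
      have h1 : ρ₀ σ = 1 := hρ₀.isUnramifiedAt_of_hasGoodReductionAt hgoodv h2v 𝔓 h𝔓 σ hσ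
      change Matrix.GeneralLinearGroup.map f (ρ₀ σ) = 1
      rw [h1, map_one]
    · intro 𝔓 h𝔓 σ hσ
      have hc := hρ₀.charpoly_eq_of_isArithFrobAt (W.trace_galoisRepTate_frobenius_of_hasGoodReductionAt_holds 2)
        (W.det_galoisRepTate_frobenius_of_hasGoodReductionAt_holds 2) h2v hgoodv h𝔓 hσ
      have hTp : ι (Ideal.Quotient.mk 𝔪 (HeckeRing0.T L 2 ((primesEquiv v : Nat.Primes) : ℕ) (primesEquiv v).2)) =
          ((W.frobeniusTraceAt v : ℤ) : k) := by
        have hmk : Ideal.Quotient.mk 𝔪 (HeckeRing0.T L 2 ((primesEquiv v : Nat.Primes) : ℕ) (primesEquiv v).2) =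
            Ideal.Quotient.mk 𝔪 ((W.LFunction (primesEquiv v : ℕ) : ℤ) : HeckeRing0 L 2) := by
          rw [Ideal.Quotient.mk_eq_mk_iff_sub_mem]
          exact hT _ (primesEquiv v).2 hpL
        rw [hmk, hι, W.lFunction_primesEquiv_eq_frobeniusTraceAt hgoodv]
      change (((ρ σ : GL (Fin 2) k) : Matrix (Fin 2) (Fin 2) k)).charpoly = _
      rw [hρapp, Matrix.charpoly_map, hc, hTp, natCard_residueField_adicCompletionIntegers v]
      simp only [Polynomial.map_add, Polynomial.map_sub, Polynomial.map_mul, Polynomial.map_pow, Polynomial.map_X,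
        Polynomial.map_C]
      rw [map_intCast f, map_natCast f]
  · -- (I) irreducible over `k`: the image contains both transvections (§1: `ρ̄_{W,2}` is onto `GL₂(𝔽₂)`)
    obtain ⟨T₁, hT₁⟩ := exists_GL_coe_eq_upperTransvection (ZMod 2)
    obtain ⟨T₂, hT₂⟩ := exists_GL_coe_eq_lowerTransvection (ZMod 2)
    obtain ⟨σ₁, h₁⟩ := exists_apply_eq_of_goodSS_two W hss hρ₀ T₁
    obtain ⟨σ₂, h₂⟩ := exists_apply_eq_of_goodSS_two W hss hρ₀ T₂
    have e₁ : ((ρ σ₁ : GL (Fin 2) k) : Matrix (Fin 2) (Fin 2) k) = !![(1 : k), 1; 0, 1] := by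
      rw [hρapp, h₁, hT₁, map_upperTransvection]
    have e₂ : ((ρ σ₂ : GL (Fin 2) k) : Matrix (Fin 2) (Fin 2) k) = !![(1 : k), 0; 1, 1] := by
      rw [hρapp, h₂, hT₂, map_lowerTransvection]
    refine isIrreducible_of_not_hasCommonEigenvector ρ.toMonoidHom ?_
    rintro ⟨w, hw0, hw⟩
    obtain ⟨a, ha⟩ := hw σ₁
    obtain ⟨b, hb⟩ := hw σ₂
    change ((ρ σ₁ : GL (Fin 2) k) : Matrix (Fin 2) (Fin 2) k) *ᵥ w = a • w at ha
    change ((ρ σ₂ : GL (Fin 2) k) : Matrix (Fin 2) (Fin 2) k) *ᵥ w = b • w at hb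
    rw [e₁] at ha
    rw [e₂] at hb
    exact hw0 (eq_zero_of_transvections_mulVec_eq_smul ha hb)
  · -- (S) non-scalar on the decomposition groups at `2` (§2: some `σ ∈ D_𝔓` has `ρ̄(σ) ≠ 1`; over `𝔽₂` the only scalar unit is `1`)
    intro v hv 𝔓 h𝔓
    obtain ⟨σ, hσ, hne⟩ := exists_mem_decompositionSubgroup_apply_ne_one_of_goodSS_two W hss hρ₀ hv h𝔓
    refine ⟨σ, hσ, fun c hc ↦ hne ?_⟩
    have hf : Function.Injective f := (algebraMap (ZMod 2) k).injective
    rw [hρapp] at hc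
    have hent : ∀ i j, f (((ρ₀ σ : GL (Fin 2) (ZMod 2)) : Matrix (Fin 2) (Fin 2) (ZMod 2)) i j) =
        Matrix.scalar (Fin 2) c i j := fun i j ↦ by
      rw [← hc]; rfl
    have h01 : ((ρ₀ σ : GL (Fin 2) (ZMod 2)) : Matrix (Fin 2) (Fin 2) (ZMod 2)) 0 1 = 0 :=
      hf (by rw [hent, map_zero]; simp)
    have h10 : ((ρ₀ σ : GL (Fin 2) (ZMod 2)) : Matrix (Fin 2) (Fin 2) (ZMod 2)) 1 0 = 0 :=
      hf (by rw [hent, map_zero]; simp)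
    have hdet : IsUnit (((ρ₀ σ : GL (Fin 2) (ZMod 2)) : Matrix (Fin 2) (Fin 2) (ZMod 2)) 0 0 *
        ((ρ₀ σ : GL (Fin 2) (ZMod 2)) : Matrix (Fin 2) (Fin 2) (ZMod 2)) 1 1) := by
      have h := (Matrix.isUnit_iff_isUnit_det _).mp (ρ₀ σ).isUnit
      rwa [Matrix.det_fin_two, h01, zero_mul, sub_zero] at h
    have hcases : ∀ x : ZMod 2, x ≠ 0 → x = 1 := by decide
    have h00 := hcases _ (IsUnit.mul_iff.mp hdet).1.ne_zero
    have h11 := hcases _ (IsUnit.mul_iff.mp hdet).2.ne_zero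
    refine Matrix.GeneralLinearGroup.ext fun i j ↦ ?_
    rw [Units.val_one]
    fin_cases i <;> fin_cases j
    · simpa using h00
    · simpa using h01
    · simpa using h10
    · simpa using h11

/-! ## §4 (K2) from {ES, SD, Bz} — no Serre 1972 -/

/-- (SERRE-FREE re-threading of `kTwo_of_dvd_of_threeFacts`: the hypothesis `serre1972_supersingular_decompositionSubgroup_image` is
REMOVED, `hsub` coming from `finrank_torsionBySet_eq_two_of_buzzard`; statement otherwise verbatim.) **(K2) at the crux's own level from
{ES, SD, Bz}**: for `W` globally minimal, `GoodSS W 2`, `Δ_W < 0`, newform `f` of level `N`, `S ≠ ∅` finite set of primes, `L` odd with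
`N·∏_{ℓ∈S} ℓ² ∣ L`, `primes(L) ⊆ S`, good reduction at every `p ∤ 2L`: every additive `K ⊇ 2Λ, (T_q^∨ − a_q(W))Λ, U_ℓ^∨Λ,` cusp-negation
differences has `x, y ∈ Λ ∖ K ⇒ x − y ∈ K`. [cite: Buzzard2000LevelLoweringModTwo, Prop. 2.4 and Def. 2.1–2.2 (p. 100–101)]
[cite: DarmonDiamondTaylor1995, §1.6 Lemma 1.38 and §4.5 Thm. 4.26] -/
theorem kTwo_of_dvd_of_esSdBz
    (hES : eichlerShimura_depletedOptimalQuotient_periodLattice_of_dvd)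
    (hSD : heckeSelfDual_torsionBy_J0) (hBz : buzzard2000_multiplicityOne_gamma0)
    (W : WeierstrassCurve ℚ) [W.IsElliptic] [W.IsGloballyMinimal] (hss : GoodSS W 2) (hΔ : W.Δ < 0)
    {N : ℕ} [NeZero N] {f : CuspForm (Gamma0 N) 2} (hf : IsNewformOf W f)
    (S : Finset ℕ) (hS : ∀ ℓ ∈ S, ℓ.Prime) (hSne : S.Nonempty)
    (L : ℕ) [NeZero L] (hL : Odd L) (hNL : N * ∏ ℓ ∈ S, ℓ ^ 2 ∣ L) (hLS : ∀ p : ℕ, p.Prime → p ∣ L → p ∈ S)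
    (hgood : ∀ v : HeightOneSpectrum (𝓞 ℚ), ¬ ((primesEquiv v : ℕ) ∣ 2 * L) → W.HasGoodReductionAt v)
    (K : AddSubgroup (Module.Dual ℂ (CuspForm (Gamma0 L) 2)))
    (h2K : ∀ x ∈ periodHomology L, (2 : ℂ) • x ∈ K)
    (hTK : ∀ (q : ℕ) (hq : q.Prime), ¬ q ∣ L → ∀ x ∈ periodHomology L,
      (haveI : NeZero q := ⟨hq.ne_zero⟩; heckeT (Gamma0 L) 2 q).dualMap x - (W.LFunction q : ℂ) • x ∈ K)
    (hUK : ∀ (q : ℕ) (hq : q.Prime), q ∣ L → ∀ x ∈ periodHomology L,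
      (haveI : NeZero q := ⟨hq.ne_zero⟩; heckeT (Gamma0 L) 2 q).dualMap x ∈ K)
    (hcK : ∀ γ : Gamma0 L, periodFunctional L ⟨iotaConj (γ : SL(2, ℤ)), iotaConj_coe_mem_gamma0 γ⟩ - periodFunctional L γ ∈ K)
    {x y : Module.Dual ℂ (CuspForm (Gamma0 L) 2)} (hx : x ∈ periodHomology L) (hy : y ∈ periodHomology L)
    (hxK : x ∉ K) (hyK : y ∉ K) : x - y ∈ K := by
  classical
  set G : Set (HeckeRing0 L 2) := {t : HeckeRing0 L 2 | t = 2 ∨ (∃ (q : ℕ) (hq : q.Prime), ¬ q ∣ L ∧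
      t = HeckeRing0.T L 2 q hq - (W.LFunction q : HeckeRing0 L 2)) ∨ (∃ (q : ℕ) (hq : q.Prime), q ∣ L ∧
      t = HeckeRing0.T L 2 q hq)} with hGdef
  by_cases hne : Ideal.span G = ⊤
  · -- vacuous case: `K ⊇ 𝔪₀Λ = Λ ∋ x`
    exfalso
    apply hxK
    have hK𝔪 : ∀ z ∈ Ideal.span G • periodHomologyHecke L, z ∈ K := by
      refine mem_of_mem_ideal_span_smul G K fun s hs z hz ↦ ?_
      rcases hs with rfl | ⟨q, hq', hqL, rfl⟩ | ⟨q, hq', hqL, rfl⟩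
      · have : (2 : HeckeRing0 L 2) • z = (2 : ℂ) • z := by
          rw [show (2 : HeckeRing0 L 2) = ((2 : ℤ) : HeckeRing0 L 2) by norm_num, heckeRing0_intCast_smul, Int.cast_ofNat]
        rw [this]
        exact h2K z hz
      · rw [sub_smul, heckeRing0_T_smul, heckeRing0_intCast_smul]
        exact hTK q hq' hqL z hz
      · rw [heckeRing0_T_smul]
        exact hUK q hq' hqL z hz
    apply hK𝔪
    rw [hne, Submodule.top_smul]
    exact (mem_periodHomologyHecke L).mpr hx
  · have h2 : (2 : HeckeRing0 L 2) ∈ Ideal.span G := Ideal.subset_span (Or.inl rfl)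
    have hq := natCard_quotient_eq_two_of_ne_top (Ideal.span G) h2 (eigenIdeal_T_sub_int_mem W) hne
    haveI h𝔪 : (Ideal.span G).IsMaximal := isMaximal_of_natCard_quotient_eq_two _ hq
    have hT : ∀ (q : ℕ) (hq' : q.Prime), ¬ q ∣ L →
        HeckeRing0.T L 2 q hq' - (W.LFunction q : HeckeRing0 L 2) ∈ Ideal.span G :=
      fun q hq' hqL ↦ Ideal.subset_span (Or.inr (Or.inl ⟨q, hq', hqL, rfl⟩))
    have hsub := finrank_torsionBySet_eq_two_of_buzzard hBz W hss L hL hgood (Ideal.span G) h𝔪 h2 hq hT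
    exact kTwo_of_dvd_noMazur hES hSD W hss hΔ hf S hS hSne L hNL hLS hsub K h2K hTK hUK hcK hx hy hxK hyK

/-! ## §5 (C3k) in characteristic `2` from THREE facts -/

/-- (SERRE-FREE form of `plusLineCharTwo_of_fourFacts`: three named facts instead of four; CONCLUSION VERBATIM.) **(C3k) «plus multiplicity one
over fields of characteristic `2`» at every level of the crux's shape, from the named facts {ES, SD, Bz}.** For `W` globally minimal with
`GoodSS W 2` and `Δ_W < 0`, an odd level `N'` with a newform `f` of `W` of level `N`, a nonempty finite set of primes `S` with `N·∏_{ℓ∈S} ℓ² ∣ N'`,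
`primes(N') ⊆ S` and good reduction at every `p ∤ 2N'`: for every field `k` of characteristic `2`, two nonzero even `1`-periodic
Γ₀(N')-symbol functions `Ψ₁, Ψ₂ : ℚ → k` that are exact Hecke eigenfunctions (`T_q ↦ a_q(W)`, `q ∤ N'`; `U_ℓ ↦ 0`, `ℓ ∣ N'`) are proportional.
Proof: `plusLineCharTwo_of_kTwo` with (K2) = `kTwo_of_dvd_of_esSdBz`. The hypothesis `serre1972_supersingular_decompositionSubgroup_image`
of the four-fact form is discharged by §1–§2 (surjectivity of `ρ̄_{W,2}` and `Δ_min ≡ 5 mod 8`). BSD is not proved by this.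
[cite: Buzzard2000LevelLoweringModTwo, Prop. 2.4 and Def. 2.1–2.2 (p. 100–101)] [cite: Manin1972, Thm. 1.9]
[cite: DokchitserDokchitserMathZ2012, Theorem (1)] -/
theorem plusLineCharTwo_of_threeFacts
    (hES : eichlerShimura_depletedOptimalQuotient_periodLattice_of_dvd)
    (hSD : heckeSelfDual_torsionBy_J0) (hBz : buzzard2000_multiplicityOne_gamma0) :
    ∀ (W : WeierstrassCurve ℚ) [W.IsElliptic] [W.IsGloballyMinimal], GoodSS W 2 → W.Δ < 0 → ∀ (N' : ℕ), Odd N' →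
    ∀ {N : ℕ} [NeZero N] (f : CuspForm (Gamma0 N) 2), IsNewformOf W f →
    ∀ (S : Finset ℕ), (∀ ℓ ∈ S, ℓ.Prime) → S.Nonempty → N * ∏ ℓ ∈ S, ℓ ^ 2 ∣ N' → (∀ p : ℕ, p.Prime → p ∣ N' → p ∈ S) →
    (∀ v : HeightOneSpectrum (𝓞 ℚ), ¬ ((primesEquiv v : ℕ) ∣ 2 * N') → W.HasGoodReductionAt v) →
    ∀ (k : Type) [Field k] [CharP k 2] (Ψ₁ Ψ₂ : ℚ → k), (∀ (r : ℚ) (z : ℤ), Ψ₁ (r + z) = Ψ₁ r) → (∀ r : ℚ, Ψ₁ (-r) = Ψ₁ r) → (∀ (γ : CongruenceSubgroup.Gamma0 (N')) (r : ℚ), ((γ : SL(2, ℤ)) 1 0 : ℚ) * r + ((γ : SL(2, ℤ)) 1 1 : ℚ) ≠ 0 → Ψ₁ ((((γ : SL(2, ℤ)) 0 0 : ℚ) * r + ((γ : SL(2, ℤ)) 0 1 : ℚ)) / (((γ : SL(2, ℤ)) 1 0 : ℚ) * r + ((γ : SL(2, ℤ)) 1 1 : ℚ))) = (if ((γ : SL(2,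 ℤ)) 1 0) = 0 then 0 else Ψ₁ ((((γ : SL(2, ℤ)) 0 0 : ℚ)) / (((γ : SL(2, ℤ)) 1 0 : ℚ)))) + Ψ₁ r) → (∀ (r : ℚ) (z : ℤ), Ψ₂ (r + z) = Ψ₂ r) → (∀ r : ℚ, Ψ₂ (-r) = Ψ₂ r) → (∀ (γ : CongruenceSubgroup.Gamma0 (N')) (r : ℚ), ((γ : SL(2, ℤ)) 1 0 : ℚ) * r + ((γ : SL(2, ℤ)) 1 1 : ℚ) ≠ 0 → Ψ₂ ((((γ : SL(2, ℤ)) 0 0 : ℚ) * r + ((γ : SL(2, ℤ)) 0 1 : ℚ)) / (((γ : SL(2, ℤ)) 1 0 : ℚ) * r + ((γ : SL(2, ℤ)) 1 1 : ℚ))) = (if ((γ : SL(2, ℤ)) 1 0) = 0 then 0 else Ψ₂ ((((γ : SL(2, ℤ)) 0 0 : ℚ)) / (((γ : SL(2, ℤ)) 1 0 : ℚ)))) + Ψ₂ r) → (∃ r : ℚ, Ψ₁ r ≠ 0) → (∃ r : ℚ, Ψ₂ r ≠ 0) → (∀ q : ℕ, q.Prime → ¬ q ∣ N' → ∀ r :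 ℚ, (∑ j : Fin q, Ψ₁ ((r + j) / q)) + Ψ₁ (q * r) = (W.LFunction q : k) * Ψ₁ r) → (∀ q : ℕ, q.Prime → ¬ q ∣ N' → ∀ r : ℚ, (∑ j : Fin q, Ψ₂ ((r + j) / q)) + Ψ₂ (q * r) = (W.LFunction q : k) * Ψ₂ r) → (∀ ℓ : ℕ, ℓ.Prime → ℓ ∣ N' → ∀ r : ℚ, ∑ j : Fin ℓ, Ψ₁ ((r + j) / ℓ) = 0) → (∀ ℓ : ℕ, ℓ.Prime → ℓ ∣ N' → ∀ r : ℚ, ∑ j : Fin ℓ, Ψ₂ ((r + j) / ℓ) = 0) → ∃ c : k, ∀ r : ℚ, Ψ₂ r = c * Ψ₁ r := by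
  intro W _ _ hss hΔ N' hN' N _ f hf S hS hSne hNL hLS hgood k _ _ Ψ₁ Ψ₂ _ hev₁ hM₁ _ hev₂ hM₂ hne₁ _ hT₁ hT₂ hU₁ hU₂
  haveI : NeZero N' := ⟨by rintro rfl; exact (Nat.not_even_iff_odd.mpr hN') (Even.zero)⟩
  have ha2 : ((W.LFunction 2 : ℤ) : k) = 0 := by
    rw [LFunction_apply_prime_eq_frobeniusTrace W 2 hss.1]
    obtain ⟨m, hm⟩ := hss.2
    rw [hm]
    push_cast
    rw [CharTwo.two_eq_zero, zero_mul]
  exact plusLineCharTwo_of_kTwo hN' (fun n ↦ W.LFunction n) ha2 Ψ₁ Ψ₂ hev₁ hM₁ hev₂ hM₂ hne₁ hT₁ hT₂ hU₁ hU₂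
    (fun K h2K hTK hUK hcK x hx y hy hxK hyK ↦
      kTwo_of_dvd_of_esSdBz hES hSD hBz W hss hΔ hf S hS hSne N' hN' hNL hLS hgood K h2K hTK hUK hcK hx hy hxK hyK)

end Summit.BirchSwinnertonDyer.BirchSwinnertonDyer.Theorems.ThetaLayerLambdaCongruenceAtTwo

end
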